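/-
Copyright (c) 2026 the pub-hodgecm-mathlib formalisation cell (harness21).  Prover seat hodgecm-mathlib-F0P3-p01 (g31), «(D-RAM) FOUR-FRAME» road of crux H413, line LH4,
unit U3_Laws, κ-STAGE B brick κG₂ «G₁-κ» (dealer LH4-plan (g11) WORD #52 (a); letter LH4-p09 (g3) `F0/P3c/LH4/LH4-p09/g3/LETTER-kappaBG-tv2.v1.LH4p09g3.md` §4,
κ owner LH4-p05 (g3)).  FILE κG₂-C2 — THE SOCKET (glued type-2 strata, `ρ ≥ 1`).  2026-09-04.
-/
import Summits.HodgeConjecture.HodgeConjecture.Theorems.F0P3cDyRamDiagonalKappaGluedDecompositionTwo   -- ★ κG₂-C1 p856753 (this seat): orbit decomposition, stable reps by regime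
import Summits.HodgeConjecture.HodgeConjecture.Theorems.F0P3cDyRamDiagonalKappaGluedClassTwoCount      -- ★ κG₂-A2 (this seat): `kappaCount_two_latt_glued_rep`; brings part 1, ★ G2-B, ★ TraceBound
import Summits.HodgeConjecture.HodgeConjecture.Theorems.F0P3cDyRamDiagonalKappaGluedClassSumsTwo       -- ★ κG₂-B (this seat): bracket sums at level `ρ+1+2t`, sub-balls, the swap
import Summits.HodgeConjecture.HodgeConjecture.Theorems.F0P3cDyRamDiagonalGluedSocketTwoWeight         -- ★ W p856429 (this seat): `gluedPol_eq_gluedR`, `gluedR_stable_eq_empty_of_lt_typeTwo`; brings ★ F1₂, ★ p856265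
import Summits.HodgeConjecture.HodgeConjecture.Theorems.F0P3cDyRamDiagonalGluedClassRepresentatives    -- ★ p855991 (LH4-p08 (g2)): `exists_fixed_class_representatives`
import HarnessLib

/-!
# Crux `H413`, κ-STAGE B brick κG₂, FILE C2: the κ-SOCKET of the glued TYPE-2 strata `(2ρ+1, 2ρ+1+s, 2ρ+1+s)`, `ρ ≥ 1` — `Σᶠ κ_i·w = [TUBE₂]_i + [GLUE₂]_i`

Cell `hodgecm-mathlib` (D-0151), FLOOR 0, crux item H413 = `stmt-HodgeConjecture-24833`; lane `--supports stmt-HodgeConjecture-24833 --as helper` (count-neutral).  THEOREMS ONLY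
(no `def`, no instance, no notation, no `sorry`).  The type-2 twin of ★ p856706 (LH4-p09 (g3)) for `ρ ≥ 1`, LETTER κB-G₂ v1 §4 binders and RHS token for token (the `ρ = 0`
root-glued stratum — TUBE₂ term only, `q − 1` cosets — is a separate file).  ASSEMBLY: ★ F1₂ `stratumTwo_G1_eq` + ★ W `gluedPol_eq_gluedR` (polarisable ⟺ (R)) ⟹ ★ κG₂-C1
(orbits of the coarse class representatives `g ∈ R`, level `ρ+2t`, mass `q^{2ρ+2t+1−⌈(ρ+2t+1)∕2⌉}`) ⟹ ★ κG₂-A2 (per representative, `κ₂ = Σ` of the brackets over the fine classes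
`f ∈ R⁺`, `f ≡ g`, level `ρ+1+2t`) ⟹ ★ κG₂-B swap + sums (TUBE₂: whole level; GLUE₂: the sub-ball `|f − f₀| ≤ |ϖ|^{2ρ+2t+1−m}` of the stable classes, ★ κG₂-C1
`mapGL_latt_glued_rep_two_iff` + ★ bridge p856146; the empty regimes ★ W ∕ ★ p856265).
VALUES (q = #𝓀, ω = `normSign σ`): TUBE₂ (`2∣s`, `2ρ+1 ≤ min(n₂,n₃)`, `2ρ+1+s ≤ n₁`) = `(ω(−1)·q^{2ρ+s∕2}·((q−1)[2d ≤ s] − [s+2 = 2d]), 0, 0)_i` (= q × type 0);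
GLUE₂ (`2∣s`, `n₂ = n₃`, `n₁ = n₂+s`, `n₂ < 2ρ+1 ≤ 2n₂`, `2ρ+1−n₂ ≤ n₂−d+1`) = `([2d ≤ s + 2⌈(2ρ+1−n₂)∕2⌉]ω(−1)ω(1+f₀), [d ≤ ⌈(2ρ+1−n₂)∕2⌉]ω(−1)ω(f₀)ω(1+f₀),
[d ≤ ⌈(2ρ+1−n₂)∕2⌉]ω(f₀))_i · q^{2ρ+s∕2+1−⌈(2ρ+1−n₂)∕2⌉}` — REF5 R5-108: 12∕12 strata + 4 glue shells at d = t = 2.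
HONEST LABEL.  Count-neutral (`--supports`); the κ-laws stay PROVER TARGETS; `HC_CM` is proved only modulo the 7 printed citations (2 remaining named inputs: hLiu418 =
`stmt-HodgeConjecture-24832`, h413 = `stmt-HodgeConjecture-24833`) until rung 0 closes.

## References
* [Kottwitz1986BaseChangeUnits] R. E. Kottwitz, *Base change for unit elements of Hecke algebras*, Compositio Math. 60 (1986), §1 pp. 240–241 (fixed-lattice counts via torus orbits).
* [LanglandsShelstad1987] R. P. Langlands, D. Shelstad, *On the definition of transfer factors*, Math. Ann. 278 (1987), §3 (the κ-signs).
* [Rogawski1990] J. D. Rogawski, *Automorphic Representations of Unitary Groups in Three Variables*, Ann. of Math. Stud. 123 (1990), §4.9 Prop. 4.9.1 (a) p. 55.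
* [Serre1979] J.-P. Serre, *Local Fields*, GTM 67 (1979), Ch. V §3 Prop. 5, Cor. 3; Ch. XV §2.
-/

set_option autoImplicit false

noncomputable section

namespace Summit.HodgeConjecture.HodgeConjecture.Cruxes.H413.F0P3cDyRamDiagonalKappaGluedSocketTwo

open Matrix WithZero
open Literature.NumberTheory.Automorphic Literature.NumberTheory.Automorphic.HermitianLattice
open Literature.NumberTheory.Automorphic.UnitaryLatticeTree Literature.NumberTheory.Automorphic.UnitaryThreeFourFrame
open Literature.NumberTheory.LocalFields.WildQuadraticDatum
open Summit.HodgeConjecture.HodgeConjecture.Cruxes.H413.F0P3cDyRamDiagonalTorusDefs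
open Summit.HodgeConjecture.HodgeConjecture.Cruxes.H413.F0P3cDyRamDiagonalStrataDefs
open Summit.HodgeConjecture.HodgeConjecture.Cruxes.H413.F0P3cDyRamDiagonalKappaCountDefs
open Summit.HodgeConjecture.HodgeConjecture.Cruxes.H413.F0P3cDyRamDiagonalKappaGluedDecompositionTwo
open Summit.HodgeConjecture.HodgeConjecture.Cruxes.H413.F0P3cDyRamDiagonalKappaGluedClassTwoCount (kappaCount_two_latt_glued_rep)
open Summit.HodgeConjecture.HodgeConjecture.Cruxes.H413.F0P3cDyRamDiagonalKappaGluedClassSumsTwo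
open Summit.HodgeConjecture.HodgeConjecture.Cruxes.H413.F0P3cDyRamDiagonalKappaGluedClassSums (level_of_mem_subBall)
open Summit.HodgeConjecture.HodgeConjecture.Cruxes.H413.F0P3cDyRamDiagonalGluedStabiliserIndex (ne_zero_and_v_lt_one_of_v_eq_exp)
open Summit.HodgeConjecture.HodgeConjecture.Cruxes.H413.F0P3cDyRamDiagonalGluedStratumTwo (stratumTwo_G1_eq stratumTwo_G1_eq_empty_of_odd)
open Summit.HodgeConjecture.HodgeConjecture.Cruxes.H413.F0P3cDyRamDiagonalGluedSocketTwoWeight (gluedPol_eq_gluedR gluedR_stable_eq_empty_of_lt_typeTwo)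
open Summit.HodgeConjecture.HodgeConjecture.Cruxes.H413.F0P3cDyRamDiagonalGluedTubeContributionCorner (gluedR_stable_eq_empty_of_offFoot_corner)
open Summit.HodgeConjecture.HodgeConjecture.Cruxes.H413.F0P3cDyRamDiagonalGluedTorusOrbits (exists_gl_coe_eq_glued)
open Summit.HodgeConjecture.HodgeConjecture.Cruxes.H413.F0P3cDyRamDiagonalGluedClassRepresentatives (exists_fixed_class_representatives)
open Summit.HodgeConjecture.HodgeConjecture.Cruxes.H413.F0P3cDyRamGlueUnitRationalityDepth (exists_fixed_v_add_glueUnit_le_iff)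
open scoped Valued WithZero Matrix MatrixGroups

section Socket

variable {K : Type} [Field K] [Valued K ℤᵐ⁰] [CompleteSpace K] [Fintype 𝓀[K]] {σ : K →+* K} {ϖ : K} {d t : ℕ} {α β : K} {N₀ n₁ n₂ n₃ : ℕ}
  {T : GL (Fin 3) K}

/-- **κB-G₂ «GLUED-STRATA κ-SOCKET» AT VERTEX TYPE `2`, `ρ ≥ 1`** (letter κB-G₂ v1 §4): for the law's element datum `(α, β; n₁, n₂, n₃)` at threshold `N₀ ≥ d`,
`T = diag(α, β, 1)`, the dyadic fence `|2| < 1` on a complete `K` with finite residue field, axis `(2ρ+1, 2ρ+1+s, 2ρ+1+s)` with `ρ, s ≥ 1`, slot `i`, and ANY fixed `f₀` which,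
ON THE GLUE REGIME, approximates `−(β−1)∕(α−1)` to depth `2ρ+1+s−n₂` (off the glue regime `f₀ := 0` serves):  `Σᶠ_{M ∈ stratumTwo} κ_i(M)·w(M) = [TUBE₂]_i + [GLUE₂]_i`.
[cite: Kottwitz1986BaseChangeUnits, §1 pp. 240–241] [cite: LanglandsShelstad1987, §3] [cite: Rogawski1990, §4.9 Prop. 4.9.1 (a) p. 55] [cite: Serre1979, Ch. V §3 Prop. 5, Cor. 3] -/
theorem finsum_kappaCount_two_mul_stabiliserWeight_hasAxis_G1 (hD : IsRamifiedQuadraticDatum σ ϖ d t) (h2 : Valued.v (2 : K) < 1)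
    (hE : IsElementDatum σ ϖ N₀ α β n₁ n₂ n₃) (hN₀ : d ≤ N₀) (hT : (T : Matrix (Fin 3) (Fin 3) K) = Matrix.diagonal ![α, β, 1])
    (ρ s : ℕ) (hρ : 1 ≤ ρ) (hs : 1 ≤ s) (i : Fin 3) (f₀ : K) (hf₀ : σ f₀ = f₀)
    (hglue : 2 ∣ s → n₂ = n₃ → n₁ = n₂ + s → n₂ < 2 * ρ + 1 → 2 * ρ + 1 ≤ 2 * n₂ → 2 * ρ + 1 - n₂ ≤ n₂ - d + 1 →
      Valued.v (f₀ + (β - 1) / (α - 1)) ≤ Valued.v ϖ ^ (2 * ρ + 1 + s - n₂)) :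
    ∑ᶠ M ∈ stratumTwo σ ϖ T ![2 * ρ + 1, 2 * ρ + 1 + s, 2 * ρ + 1 + s], (kappaCount σ ϖ 2 i M : ℚ) * stabiliserWeight σ M =
      (if 2 ∣ s ∧ 2 * ρ + 1 ≤ min n₂ n₃ ∧ 2 * ρ + 1 + s ≤ n₁ then
          (![(normSign σ (-1 : K) : ℚ) * (Fintype.card 𝓀[K] : ℚ) ^ (2 * ρ + s / 2) *
              ((if 2 * d ≤ s then (Fintype.card 𝓀[K] : ℚ) - 1 else 0) - (if s + 2 = 2 * d then 1 else 0)), 0, 0] : Fin 3 → ℚ) i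
        else 0) +
      (if 2 ∣ s ∧ n₂ = n₃ ∧ n₁ = n₂ + s ∧ n₂ < 2 * ρ + 1 ∧ 2 * ρ + 1 ≤ 2 * n₂ ∧ 2 * ρ + 1 - n₂ ≤ n₂ - d + 1 then
          (![if 2 * d ≤ s + 2 * ((2 * ρ + 1 - n₂ + 1) / 2) then (normSign σ (-1 : K) : ℚ) * normSign σ (1 + f₀) else 0,
             if d ≤ (2 * ρ + 1 - n₂ + 1) / 2 then (normSign σ (-1 : K) : ℚ) * normSign σ f₀ * normSign σ (1 + f₀) else 0,
             if d ≤ (2 * ρ + 1 - n₂ + 1) / 2 then (normSign σ f₀ : ℚ) else 0] : Fin 3 → ℚ) i *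
            (Fintype.card 𝓀[K] : ℚ) ^ (2 * ρ + s / 2 + 1 - (2 * ρ + 1 - n₂ + 1) / 2)
        else 0) := by
  classical
  have hTr := trace_bound_of_isRamifiedQuadraticDatum hD h2
  obtain ⟨hσ, hvσ, hϖ, hfix, hdd, h1d, -⟩ := id hD
  obtain ⟨hαn, hβn, -, hα1, hβ1, h₁, h₂, h₃, hN1, hN2, hN3⟩ := hE
  have hα := UnitaryThreeFourFrame.v_eq_one_of_mul_map_eq_one hvσ hαn
  have hβ := UnitaryThreeFourFrame.v_eq_one_of_mul_map_eq_one hvσ hβn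
  have h₃' : Valued.v (β - α) = Valued.v ϖ ^ n₃ := by rw [Valuation.map_sub_swap, h₃]
  obtain ⟨hϖ0, hϖ1⟩ := ne_zero_and_v_lt_one_of_v_eq_exp hϖ
  have hvϖ : 0 < Valued.v ϖ := (Valuation.pos_iff _).2 hϖ0
  obtain ⟨hi1, hi2, -⟩ := isoceles_depths hϖ h₁ h₂ h₃
  have hq1 : 1 < Nat.card 𝓀[K] := Finite.one_lt_card
  have hq0 : (Nat.card 𝓀[K] : ℚ) ≠ 0 := by exact_mod_cast (by omega : Nat.card 𝓀[K] ≠ 0)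
  have hmono : ∀ {a b : ℕ}, a ≤ b → Valued.v ϖ ^ b ≤ Valued.v ϖ ^ a := fun h => pow_le_pow_right_of_le_one' hϖ1.le h
  rw [← Nat.card_eq_fintype_card]
  by_cases hpar : 2 ∣ s
  · obtain ⟨t', rfl⟩ := hpar
    have ht' : 1 ≤ t' := by omega
    rw [show 2 * t' / 2 = t' by omega, stratumTwo_G1_eq hvσ hfix hϖ T hρ hs, gluedPol_eq_gluedR hσ hvσ hϖ0 hϖ1 hTr T ρ t' hρ ht']
    -- the COARSE class representatives (level `ρ + 2t'`) and their reference frames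
    obtain ⟨R₀, hR₀fin, -, hR1, hR2, hR3⟩ := exists_fixed_class_representatives hσ hvσ hfix hϖ hdd ρ t' hρ
    set R : Finset K := hR₀fin.toFinset with hRdef
    have hmemR : ∀ g, g ∈ R ↔ g ∈ R₀ := fun g => Set.Finite.mem_toFinset hR₀fin
    have hR1' : ∀ g ∈ R, σ g = g ∧ Valued.v g = Valued.v ϖ ^ (2 * t') := fun g hg => hR1 g ((hmemR g).1 hg)
    have hR2' : ∀ f : K, σ f = f → Valued.v f = Valued.v ϖ ^ (2 * t') → ∃ g ∈ R, Valued.v (f - g) ≤ Valued.v ϖ ^ (ρ + 2 * t') :=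
      fun f hσf hvf => by obtain ⟨g, hg, h⟩ := hR2 f hσf hvf; exact ⟨g, (hmemR g).2 hg, h⟩
    have hR3' : ∀ g ∈ R, ∀ g' ∈ R, Valued.v (g - g') ≤ Valued.v ϖ ^ (ρ + 2 * t') → g = g' :=
      fun g hg g' hg' h => hR3 g ((hmemR g).1 hg) g' ((hmemR g').1 hg') h
    choose V₀ hV₀ using fun g : K => exists_gl_coe_eq_glued (1 : K) 1 g (pow_ne_zero ρ hϖ0) (pow_ne_zero (2 * ρ + 2 * t' + 1) hϖ0)
    -- the FINE class representatives (level `ρ + 1 + 2t'`)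
    obtain ⟨P₀, hP₀fin, hP₀card, hP1, hP2, hP3⟩ := exists_fixed_class_representatives hσ hvσ hfix hϖ hdd (ρ + 1) t' (by omega)
    set Rp : Finset K := hP₀fin.toFinset with hRpdef
    have hmemRp : ∀ f, f ∈ Rp ↔ f ∈ P₀ := fun f => Set.Finite.mem_toFinset hP₀fin
    have hRpcard : Rp.card = (Nat.card 𝓀[K] - 1) * Nat.card 𝓀[K] ^ ((ρ + 1 + 1) / 2 - 1) := by rw [hRpdef, ← Set.ncard_eq_toFinset_card P₀ hP₀fin]; exact hP₀card
    have hP1' : ∀ f ∈ Rp, σ f = f ∧ Valued.v f = Valued.v ϖ ^ (2 * t') := fun f hf => hP1 f ((hmemRp f).1 hf)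
    have hP2' : ∀ f : K, σ f = f → Valued.v f = Valued.v ϖ ^ (2 * t') → ∃ g ∈ Rp, Valued.v (f - g) ≤ Valued.v ϖ ^ (ρ + 1 + 2 * t') :=
      fun f hσf hvf => by obtain ⟨g, hg, h⟩ := hP2 f hσf hvf; exact ⟨g, (hmemRp g).2 hg, h⟩
    have hP3' : ∀ g ∈ Rp, ∀ g' ∈ Rp, Valued.v (g - g') ≤ Valued.v ϖ ^ (ρ + 1 + 2 * t') → g = g' :=
      fun g hg g' hg' h => hP3 g ((hmemRp g).1 hg) g' ((hmemRp g').1 hg') h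
    -- valuation bookkeeping: anything `𝔭^{ρ+2t'}`-close to a `g ∈ R` has valuation `|ϖ|^{2t'}`
    have hlt : Valued.v ϖ ^ (ρ + 2 * t') < Valued.v ϖ ^ (2 * t') := pow_lt_pow_right_of_lt_one₀ hvϖ hϖ1 (by omega)
    have hval : ∀ g f : K, Valued.v g = Valued.v ϖ ^ (2 * t') → Valued.v (g - f) ≤ Valued.v ϖ ^ (ρ + 2 * t') → Valued.v f = Valued.v ϖ ^ (2 * t') := by
      intro g f hg hgf
      have h := Valuation.map_sub_eq_of_lt_left Valued.v (hg ▸ hgf.trans_lt hlt : Valued.v (g - f) < Valued.v g)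
      rw [← hg, ← h, sub_sub_cancel]
    -- the bracket vector
    set B : K → ℤ := fun f => (![if 2 * d ≤ ρ + 2 * t' + 2 then normSign σ (-1) * normSign σ (1 + f) else 0,
         if 2 * d ≤ ρ + 2 then normSign σ (-1) * normSign σ f * normSign σ (1 + f) else 0,
         if 2 * d ≤ ρ + 2 then normSign σ f else 0] : Fin 3 → ℤ) i with hB
    -- PER REPRESENTATIVE: `κ₂(latt V₀ g) = Σ_{f ∈ Rp, f ≡ g} B f` (★ κG₂-A2)
    have hκ : ∀ g ∈ R, kappaCount σ ϖ 2 i (latt (V₀ g : Matrix (Fin 3) (Fin 3) K)) =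
        ∑ f ∈ Rp.filter (fun f => Valued.v (g - f) ≤ Valued.v ϖ ^ (ρ + 2 * t')), B f := by
      intro g hg
      obtain ⟨hσg, hvg⟩ := hR1' g hg
      refine kappaCount_two_latt_glued_rep hD h2 hρ ht' hσg hvg (V₀ g) (hV₀ g) _ (fun f hf => ?_) (fun f' hσf' hgf' => ?_) (fun f hf f' hf' h => ?_) i
      · obtain ⟨hfR, hgf⟩ := Finset.mem_filter.1 hf
        exact ⟨(hP1' f hfR).1, hgf⟩
      · obtain ⟨f, hfR, hff⟩ := hP2' f' hσf' (hval g f' hvg hgf')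
        refine ⟨f, Finset.mem_filter.2 ⟨hfR, ?_⟩, by rw [show ρ + 2 * t' + 1 = ρ + 1 + 2 * t' by ring]; exact hff⟩
        rw [show g - f = (g - f') + (f' - f) by ring]
        exact Valuation.map_add_le _ hgf' (hff.trans (hmono (by omega)))
      · exact hP3' f (Finset.mem_filter.1 hf).1 f' (Finset.mem_filter.1 hf').1 (by rw [show ρ + 1 + 2 * t' = ρ + 2 * t' + 1 by ring]; exact h)
    -- the swap data: every fine class lies in exactly one coarse class
    have hcover : ∀ f ∈ Rp, ∃ g ∈ R, Valued.v (g - f) ≤ Valued.v ϖ ^ (ρ + 2 * t') := fun f hf => by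
      obtain ⟨g, hg, h⟩ := hR2' f (hP1' f hf).1 (hP1' f hf).2
      exact ⟨g, hg, by rw [Valuation.map_sub_swap]; exact h⟩
    have huniq : ∀ f ∈ Rp, ∀ g ∈ R, ∀ g' ∈ R, Valued.v (g - f) ≤ Valued.v ϖ ^ (ρ + 2 * t') → Valued.v (g' - f) ≤ Valued.v ϖ ^ (ρ + 2 * t') → g = g' :=
      fun f _ g hg g' hg' h h' => hR3' g hg g' hg' (by rw [show g - g' = (g - f) - (g' - f) by ring]; exact Valuation.map_sub_le _ h h')
    -- exponent bookkeeping
    have hj : (ρ + 2 * t' + 2) / 2 = (ρ + 2) / 2 + t' := by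
      rw [show ρ + 2 * t' + 2 = ρ + 2 + t' * 2 by ring, Nat.add_mul_div_right _ _ (by norm_num : 0 < 2)]
    by_cases htube : 2 * ρ + 2 * t' + 1 ≤ n₁ ∧ 2 * ρ + 1 ≤ n₂
    · -- THE TUBE: every representative is stable
      have hn₃ : 2 * ρ + 1 ≤ n₃ := le_trans (le_min (by omega) htube.2) hi1
      rw [if_pos (show 2 ∣ 2 * t' ∧ 2 * ρ + 1 ≤ min n₂ n₃ ∧ 2 * ρ + 1 + 2 * t' ≤ n₁ from ⟨dvd_mul_right 2 t', le_min htube.2 hn₃, by omega⟩),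
        if_neg (show ¬ (2 ∣ 2 * t' ∧ n₂ = n₃ ∧ n₁ = n₂ + 2 * t' ∧ n₂ < 2 * ρ + 1 ∧ 2 * ρ + 1 ≤ 2 * n₂ ∧ 2 * ρ + 1 - n₂ ≤ n₂ - d + 1) from
          fun h => absurd h.2.2.2.1 (not_lt.2 htube.2)), add_zero,
        finsum_kappaCount_two_mul_stabiliserWeight_glued_eq hσ hvσ hfix hϖ hdd T hT ρ t' hρ R hR1' hR2' hR3' V₀ hV₀ i,
        Finset.filter_true_of_mem (fun g hg => mapGL_latt_glued_rep_two_of_depths hϖ0 hϖ1.le hα hβ T hT h₁ h₂ h₃' htube.1 htube.2 (by omega) (hR1' g hg).2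
          (V₀ g) (hV₀ g)),
        Finset.sum_congr rfl (fun g hg => by rw [hκ g hg]), ]
      rw [show ∑ g ∈ R, ((∑ f ∈ Rp.filter (fun f => Valued.v (g - f) ≤ Valued.v ϖ ^ (ρ + 2 * t')), B f : ℤ) : ℚ) =
          ∑ g ∈ R, ∑ f ∈ Rp.filter (fun f => Valued.v (g - f) ≤ Valued.v ϖ ^ (ρ + 2 * t')), (B f : ℚ) from
          Finset.sum_congr rfl fun g _ => by push_cast; rfl,
        sum_sum_filter_near_eq R Rp (fun g f => Valued.v (g - f) ≤ Valued.v ϖ ^ (ρ + 2 * t')) hcover huniq (fun f => (B f : ℚ)),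
        hB, sum_bracket_two_level hD h2 ht' Rp hP1' hP2' hP3' hRpcard i]
      fin_cases i
      · simp only [Fin.zero_eta, Fin.isValue, Matrix.cons_val_zero]
        have e1 : 2 * ρ + 2 * t' + 1 - (ρ + 2 * t' + 2) / 2 + ((ρ + 1 + 1) / 2 - 1) = 2 * ρ + t' := by rw [hj]; omega
        have epow : (Nat.card 𝓀[K] : ℚ) ^ (2 * ρ + t') =
            (Nat.card 𝓀[K] : ℚ) ^ (2 * ρ + 2 * t' + 1 - (ρ + 2 * t' + 2) / 2) * (Nat.card 𝓀[K] : ℚ) ^ ((ρ + 1 + 1) / 2 - 1) := by rw [← pow_add, e1]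
        by_cases hdt : d ≤ t'
        · rw [if_pos hdt, if_neg (show ¬ (t' + 1 = d) by omega), if_pos (show 2 * d ≤ 2 * t' by omega),
            if_neg (show ¬ (2 * t' + 2 = 2 * d) by omega), epow]
          ring
        · rw [if_neg hdt, if_neg (show ¬ (2 * d ≤ 2 * t') by omega)]
          by_cases hbd : t' + 1 = d
          · rw [if_pos hbd, if_pos (show 2 * t' + 2 = 2 * d by omega), epow]
            ring
          · rw [if_neg hbd, if_neg (show ¬ (2 * t' + 2 = 2 * d) by omega)]
            ring
      · simp
      · simp
    · rw [if_neg (show ¬ (2 ∣ 2 * t' ∧ 2 * ρ + 1 ≤ min n₂ n₃ ∧ 2 * ρ + 1 + 2 * t' ≤ n₁) from fun h => htube ⟨by omega, (le_min_iff.1 h.2.1).1⟩), zero_add]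
      by_cases hfoot : n₁ = n₂ + 2 * t'
      · -- ON THE FOOT: `n₃ = n₂ < 2ρ+1`
        have hn₃ : n₃ = n₂ := by
          rcases min_le_iff.1 hi1 with h | h <;> rcases min_le_iff.1 hi2 with h' | h' <;> omega
        subst hn₃
        have hm : n₃ < 2 * ρ + 1 := by
          by_contra hge
          exact htube ⟨by omega, not_lt.1 hge⟩
        rw [hfoot] at h₁
        by_cases hρm : ρ + 1 ≤ n₃
        · -- THE GLUE CANDIDATES `ρ+1 ≤ m < 2ρ+1`: stable reps = the sub-ball around `−(β−1)∕(α−1)`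
          have hvϖ0 : Valued.v ϖ ≠ 0 := hvϖ.ne'
          have h₁' : Valued.v (β - 1) = Valued.v ϖ ^ (n₃ + 2 * t') := h₁
          have hg : Valued.v ((β - 1) / (α - 1)) = Valued.v ϖ ^ (2 * t') := by
            rw [map_div₀, h₁', h₂, pow_add, mul_div_cancel_left₀ _ (pow_ne_zero n₃ hvϖ0)]
          have hαd : Valued.v (α - 1) ≤ Valued.v ϖ ^ d := by rw [h₂]; exact hmono (by omega)
          have hβd : Valued.v (β - 1) ≤ Valued.v ϖ ^ d := by rw [h₁']; exact hmono (by omega)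
          have hswitch := exists_fixed_v_add_glueUnit_le_iff hσ hvσ hfix hϖ hdd h1d hαn hβn hα1 hβ1 hαd hβd h₃ (by omega) hg
            (by omega : 2 * t' ≤ 2 * ρ + 2 * t' + 1 - n₃)
          rw [finsum_kappaCount_two_mul_stabiliserWeight_glued_eq hσ hvσ hfix hϖ hdd T hT ρ t' hρ R hR1' hR2' hR3' V₀ hV₀ i,
            Finset.filter_congr (fun g hg => mapGL_latt_glued_rep_two_iff hϖ hα hβ T hT h₁' h₂ h₃' hρm (by omega) g (V₀ g) (hV₀ g))]
          by_cases hdepth : 2 * ρ + 1 - n₃ ≤ n₃ - d + 1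
          · -- THE GLUE REGIME: `f₀` approximates the glue unit
            have hf₀' : Valued.v (f₀ + (β - 1) / (α - 1)) ≤ Valued.v ϖ ^ (2 * ρ + 2 * t' + 1 - n₃) := by
              have h := hglue (dvd_mul_right 2 t') rfl hfoot hm (by omega) hdepth
              rwa [show 2 * ρ + 1 + 2 * t' - n₃ = 2 * ρ + 2 * t' + 1 - n₃ by omega] at h
            rw [if_pos ⟨dvd_mul_right 2 t', rfl, hfoot, hm, by omega, hdepth⟩]
            -- `|f₀| = |ϖ|^{2t'}`
            have hlt₂ : Valued.v ϖ ^ (2 * ρ + 2 * t' + 1 - n₃) < Valued.v ϖ ^ (2 * t') := pow_lt_pow_right_of_lt_one₀ hvϖ hϖ1 (by omega)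
            have hvf₀ : Valued.v f₀ = Valued.v ϖ ^ (2 * t') := by
              have h := Valuation.map_sub_eq_of_lt_left Valued.v (hg ▸ (by rw [show (β - 1) / (α - 1) - (-f₀) = f₀ + (β - 1) / (α - 1) by ring]; exact hf₀'.trans_lt hlt₂) :
                Valued.v ((β - 1) / (α - 1) - (-f₀)) < Valued.v ((β - 1) / (α - 1)))
              rw [show (β - 1) / (α - 1) - ((β - 1) / (α - 1) - -f₀) = -f₀ by ring, Valuation.map_neg] at h
              rw [h, hg]
            have hnear : ∀ g : K, Valued.v (g + (β - 1) / (α - 1)) ≤ Valued.v ϖ ^ (2 * ρ + 2 * t' + 1 - n₃) ↔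
                Valued.v (g - f₀) ≤ Valued.v ϖ ^ (2 * ρ + 2 * t' + 1 - n₃) := fun g => by
              constructor
              · intro h
                rw [show g - f₀ = (g + (β - 1) / (α - 1)) - (f₀ + (β - 1) / (α - 1)) by ring]
                exact Valuation.map_sub_le _ h hf₀'
              · intro h
                rw [show g + (β - 1) / (α - 1) = (g - f₀) + (f₀ + (β - 1) / (α - 1)) by ring]
                exact Valuation.map_add_le _ h hf₀'
            -- the stable COARSE representatives and the FINE sub-ball system
            set R' : Finset K := R.filter (fun g => Valued.v (g + (β - 1) / (α - 1)) ≤ Valued.v ϖ ^ (2 * ρ + 2 * t' + 1 - n₃)) with hR'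
            set S : Finset K := Rp.filter (fun f => Valued.v (f - f₀) ≤ Valued.v ϖ ^ (2 * ρ + 2 * t' + 1 - n₃)) with hS
            have hS1 : ∀ f ∈ S, f ∈ {g : K | σ g = g ∧ Valued.v (g - f₀) ≤ Valued.v ϖ ^ (2 * ρ + 2 * t' + 1 - n₃)} := fun f hf => by
              obtain ⟨hfR, hfe⟩ := Finset.mem_filter.1 hf
              exact ⟨(hP1' f hfR).1, hfe⟩
            have hS2 : ∀ f ∈ {g : K | σ g = g ∧ Valued.v (g - f₀) ≤ Valued.v ϖ ^ (2 * ρ + 2 * t' + 1 - n₃)},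
                ∃ g ∈ S, Valued.v (f - g) ≤ Valued.v ϖ ^ (ρ + 1 + 2 * t') := by
              intro f hf
              obtain ⟨hσf, hvf⟩ := level_of_mem_subBall hD (by omega) hvf₀ hf
              obtain ⟨g, hg, hfg⟩ := hP2' f hσf hvf
              refine ⟨g, Finset.mem_filter.2 ⟨hg, ?_⟩, hfg⟩
              rw [show g - f₀ = (f - f₀) - (f - g) by ring]
              exact Valuation.map_sub_le _ hf.2 (hfg.trans (hmono (by omega)))
            have hS3 : ∀ g ∈ S, ∀ g' ∈ S, Valued.v (g - g') ≤ Valued.v ϖ ^ (ρ + 1 + 2 * t') → g = g' :=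
              fun g hg g' hg' h => hP3' g (Finset.mem_filter.1 hg).1 g' (Finset.mem_filter.1 hg').1 h
            -- the swap on the stable classes: for a stable coarse class, its fine classes are exactly its fine classes inside the sub-ball
            have hinner : ∀ g ∈ R', Rp.filter (fun f => Valued.v (g - f) ≤ Valued.v ϖ ^ (ρ + 2 * t')) =
                S.filter (fun f => Valued.v (g - f) ≤ Valued.v ϖ ^ (ρ + 2 * t')) := by
              intro g hg
              obtain ⟨-, hge⟩ := Finset.mem_filter.1 hg
              ext f
              simp only [hS, Finset.mem_filter]
              constructor
              · rintro ⟨hfR, hgf⟩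
                refine ⟨⟨hfR, (hnear f).1 ?_⟩, hgf⟩
                rw [show f + (β - 1) / (α - 1) = (g + (β - 1) / (α - 1)) - (g - f) by ring]
                exact Valuation.map_sub_le _ hge (hgf.trans (hmono (by omega)))
              · rintro ⟨⟨hfR, -⟩, hgf⟩; exact ⟨hfR, hgf⟩
            have hcover' : ∀ f ∈ S, ∃ g ∈ R', Valued.v (g - f) ≤ Valued.v ϖ ^ (ρ + 2 * t') := by
              intro f hf
              obtain ⟨hfR, hfe⟩ := Finset.mem_filter.1 hf
              obtain ⟨g, hg, hgf⟩ := hcover f hfR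
              refine ⟨g, Finset.mem_filter.2 ⟨hg, ?_⟩, hgf⟩
              rw [show g + (β - 1) / (α - 1) = (g - f) + ((f - f₀) + (f₀ + (β - 1) / (α - 1))) by ring]
              exact Valuation.map_add_le _ (hgf.trans (hmono (by omega))) (Valuation.map_add_le _ hfe hf₀')
            have huniq' : ∀ f ∈ S, ∀ g ∈ R', ∀ g' ∈ R', Valued.v (g - f) ≤ Valued.v ϖ ^ (ρ + 2 * t') →
                Valued.v (g' - f) ≤ Valued.v ϖ ^ (ρ + 2 * t') → g = g' :=
              fun f hf g hg g' hg' h h' => huniq f (Finset.mem_filter.1 hf).1 g (Finset.mem_filter.1 hg).1 g' (Finset.mem_filter.1 hg').1 h h'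
            rw [Finset.sum_congr rfl (fun g hg => by rw [hκ g (Finset.mem_filter.1 hg).1, hinner g hg]),
              show ∑ g ∈ R', ((∑ f ∈ S.filter (fun f => Valued.v (g - f) ≤ Valued.v ϖ ^ (ρ + 2 * t')), B f : ℤ) : ℚ) =
                ∑ g ∈ R', ∑ f ∈ S.filter (fun f => Valued.v (g - f) ≤ Valued.v ϖ ^ (ρ + 2 * t')), (B f : ℚ) from
                Finset.sum_congr rfl fun g _ => by push_cast; rfl,
              sum_sum_filter_near_eq R' S (fun g f => Valued.v (g - f) ≤ Valued.v ϖ ^ (ρ + 2 * t')) hcover' huniq' (fun f => (B f : ℚ)),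
              hB, sum_bracket_two_subBall hD h2 ht' (by omega) (by omega) hf₀ hvf₀ S hS1 hS2 hS3 i]
            have hk' : (2 * ρ + 2 * t' + 1 - n₃ + 1) / 2 = (2 * ρ + 1 - n₃ + 1) / 2 + t' := by
              rw [show 2 * ρ + 2 * t' + 1 - n₃ + 1 = 2 * ρ + 1 - n₃ + 1 + t' * 2 by omega, Nat.add_mul_div_right _ _ (by norm_num : 0 < 2)]
            have hj' : (ρ + 1 + 2 * t' + 1) / 2 = (ρ + 2) / 2 + t' := by
              rw [show ρ + 1 + 2 * t' + 1 = ρ + 2 + t' * 2 by ring, Nat.add_mul_div_right _ _ (by norm_num : 0 < 2)]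
            have hexp : 2 * ρ + 2 * t' + 1 - (ρ + 2 * t' + 2) / 2 + ((ρ + 1 + 2 * t' + 1) / 2 - (2 * ρ + 2 * t' + 1 - n₃ + 1) / 2) =
                2 * ρ + t' + 1 - (2 * ρ + 1 - n₃ + 1) / 2 := by rw [hj, hj', hk']; omega
            rw [← mul_comm ((Nat.card 𝓀[K] : ℚ) ^ _), ← mul_assoc, ← pow_add, hexp, mul_comm]
            congr 1
            fin_cases i
            · simp only [Fin.zero_eta, Fin.isValue, Matrix.cons_val_zero]
              exact if_congr (by omega) rfl rfl
            · simp only [Fin.mk_one, Fin.isValue, Matrix.cons_val_one, Matrix.cons_val_zero]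
              exact if_congr (by omega) rfl rfl
            · simp only [Fin.reduceFinMk, Matrix.cons_val_two, Matrix.tail_cons, Matrix.head_cons]
              exact if_congr (by omega) rfl rfl
          · -- BEYOND THE GLUE-UNIT DEPTH: no representative is stable
            have hnone : ∀ g ∈ R, ¬ Valued.v (g + (β - 1) / (α - 1)) ≤ Valued.v ϖ ^ (2 * ρ + 2 * t' + 1 - n₃) := fun g hg h =>
              hdepth (by have := hswitch.1 ⟨g, (hR1' g hg).1, h⟩; omega)
            rw [Finset.filter_false_of_mem hnone, Finset.sum_empty, mul_zero, if_neg (fun h => hdepth h.2.2.2.2.2)]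
        · -- TOO SHALLOW FOR TYPE 2: `m ≤ ρ`, `n₁ = m + 2t' < ρ + 2t' + 1`
          rw [gluedR_stable_eq_empty_of_lt_typeTwo σ hϖ hα hβ T hT h₁ ρ t' (by omega), finsum_mem_empty,
            if_neg (fun h => by have := h.2.2.2.2.1; omega)]
      · -- OFF THE FOOT, BELOW THE TUBE: nothing
        rw [gluedR_stable_eq_empty_of_offFoot_corner σ hϖ0 hϖ1 hα hβ T hT h₁ h₂ ρ t' 1 hfoot (fun h => htube ⟨by omega, by omega⟩), finsum_mem_empty,
          if_neg (fun h => hfoot h.2.2.1)]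
  · -- `s` ODD: the stratum is empty
    rw [stratumTwo_G1_eq_empty_of_odd hvσ hfix hϖ T hpar, finsum_mem_empty, if_neg (fun h => hpar h.1), if_neg (fun h => hpar h.1), add_zero]

end Socket

end Summit.HodgeConjecture.HodgeConjecture.Cruxes.H413.F0P3cDyRamDiagonalKappaGluedSocketTwo

end
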